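import Mathlib

/-!
# Route BarrierLever — item `TropicalDetCertificatesExistNearPrincipal`
# (stmt-ValiantsHypothesis-19448), part 1/2: the tailored weight and its BLOCK CALCULUS

Helper file (`--supports stmt-ValiantsHypothesis-19448`; cell valiant-natproofs, rung V4, 𝒟-side;
prover seat val-np-p1). Closes NO item; part 2/2
(`BarrierLeverTropicalDetCertificatesExistNearPrincipal.lean`) assembles the certificate.

**Setting (planner memo UTD-memo-g9 §3(n′)).** For an exchange pair `(p, q)` of cube points
(`p, q : Finset (Fin h)`) with difference set `Δ = p ∆ q`, the TAILORED WEIGHT on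
(coordinate, bit) pairs (`dcore`; as a matrix on row literals × column literals: `dmat`) is
`0` on AGREEMENT pairs (same coordinate, same bit); on RIGHT-WAY `Δ`-pairs (row `(a, p_a)`,
column `(c, q_c)`, `a, c ∈ Δ`) `1` if `a < c` and `2` if `c ≤ a`; `h + 2` («infinite») otherwise.
The block sum of an inner assignment `τ : Perm (Fin h)` for the block (row point `x`, column point
`y`) is `bsum p q x y τ = Σ_a dcore (a, x_a) (τ a, y_{τ a})`; its minimum over `τ` is the tropical
determinant of the block in the sense of items 19315 / 19316 (`dmat_lit` identifies the literal
encodings `castAdd / natAdd` of the route's statements with (coordinate, bit) pairs).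

**Results.**
(1) BLOCK LOWER BOUND (`card_add_le_bsum`): every inner assignment of a block `(x, y)` costs at
least `|x ∆ y| + [x ≠ y]` — if the cost is `< h + 2`, every moved coordinate lies in the mismatch
set `x ∆ y` (`mem_symmDiff_of_ne`), every mismatch coordinate costs `≥ 1`, and the LARGEST one
costs `2` (it cannot be paired forward).
(2) MONOTONICITY (`mono_of_bsum_lt`, `phi_eq_of_mono`): a block of cost `< h + 2` has all its
mismatches inside `Δ` with row bits `= p`'s, hence the potential `Φ z = #{a ∈ Δ : z_a = q_a}`
(`phi`) satisfies `Φ y = Φ x + |x ∆ y|`; `Φ q = |Δ|`, `Φ p = 0`.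
(3) EXCHANGE BLOCK (`bsum_incCycle`): the increasing cycle on `Δ` (`incCycle`, `finRotate`
transported along `Finset.orderIsoOfFin`) costs exactly `|Δ| + 1` on the block `(p, q)`; identity
blocks cost `0` at the identity (`bsum_self_one`).

WHAT THIS IS NOT: no statement about layouts yet (part 2); nothing on UT-D for general layouts
(item 19316), on TT / TNS / item 19717, on crux stmt-ValiantsHypothesis-14610, or on `VP` versus
`VNP`.
-/

-- layout Summits/ValiantsHypothesis/ValiantsHypothesis forces the duplicated namespace component
set_option linter.dupNamespace false

namespace Summit.ValiantsHypothesis.ValiantsHypothesis.Theorems.BarrierLever.NearPrincipal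

open Finset

variable {h : ℕ}

/-! ## 1. The tailored weight -/

/-- The core weight `dcore p q a β c γ ∈ ℕ` of pairing the row literal `(a, β)` (coordinate `a`,
bit `β`) with the column literal `(c, γ)`, tailored to the exchange pair `(p, q)` with difference
set `Δ = p ∆ q`: `0` for an AGREEMENT pair (`a = c`, `β = γ`); on RIGHT-WAY `Δ`-pairs
(`a, c ∈ Δ`, `β = [a ∈ p]`, `γ = [c ∈ q]`) `1` if `a < c` (forward) and `2` if `c ≤ a`
(diagonal or backward); `h + 2` («infinite») otherwise. -/
def dcore (p q : Finset (Fin h)) (a : Fin h) (β : Bool) (c : Fin h) (γ : Bool) : ℕ :=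
  if a = c ∧ β = γ then 0
  else if a ∈ symmDiff p q ∧ c ∈ symmDiff p q ∧ β = decide (a ∈ p) ∧ γ = decide (c ∈ q) then
    (if a < c then 1 else 2)
  else h + 2

/-- Decoded row literal: `Fin.castAdd h a ↦ (a, true)` (bit `1`, i.e. `a ∈ u`),
`Fin.natAdd h a ↦ (a, false)`. -/
def rowDec (x : Fin (h + h)) : Fin h × Bool :=
  Fin.addCases (motive := fun _ => Fin h × Bool) (fun a => (a, true)) (fun a => (a, false)) x

/-- Decoded column literal: `Fin.castAdd h c ↦ (c, false)`, `Fin.natAdd h c ↦ (c, true)`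
(bit `1`, i.e. `c ∈ w`). -/
def colDec (y : Fin (h + h)) : Fin h × Bool :=
  Fin.addCases (motive := fun _ => Fin h × Bool) (fun c => (c, false)) (fun c => (c, true)) y

/-- Row decoding of a positive literal. -/
theorem rowDec_castAdd (a : Fin h) : rowDec (Fin.castAdd h a) = (a, true) := by
  unfold rowDec; exact Fin.addCases_left _

/-- Row decoding of a negative literal. -/
theorem rowDec_natAdd (a : Fin h) : rowDec (Fin.natAdd h a) = (a, false) := by
  unfold rowDec; exact Fin.addCases_right _

/-- Column decoding of a negative literal. -/
theorem colDec_castAdd (c : Fin h) : colDec (Fin.castAdd h c) = (c, false) := by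
  unfold colDec; exact Fin.addCases_left _

/-- Column decoding of a positive literal. -/
theorem colDec_natAdd (c : Fin h) : colDec (Fin.natAdd h c) = (c, true) := by
  unfold colDec; exact Fin.addCases_right _

/-- The tailored weight matrix `D` on `Fin (h+h) × Fin (h+h)` (row literals × column literals):
decode both literals and apply `dcore`. -/
def dmat (p q : Finset (Fin h)) (x y : Fin (h + h)) : ℕ :=
  dcore p q (rowDec x).1 (rowDec x).2 (colDec y).1 (colDec y).2

/-- `dmat` on the literals of the route's statement is `dcore` on (coordinate, bit) pairs. -/
theorem dmat_lit (p q x y : Finset (Fin h)) (a c : Fin h) :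
    dmat p q (if a ∈ x then Fin.castAdd h a else Fin.natAdd h a)
      (if c ∈ y then Fin.natAdd h c else Fin.castAdd h c) =
    dcore p q a (decide (a ∈ x)) c (decide (c ∈ y)) := by
  unfold dmat
  by_cases ha : a ∈ x <;> by_cases hc : c ∈ y <;>
    simp only [ha, hc, if_true, if_false, rowDec_castAdd, rowDec_natAdd, colDec_castAdd,
      colDec_natAdd, decide_true, decide_false]

/-! ## 2. Values of the core weight -/

/-- An agreement pair costs `0`. -/
theorem dcore_self (p q : Finset (Fin h)) (a : Fin h) (β : Bool) : dcore p q a β a β = 0 := by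
  unfold dcore; simp

/-- A finite weight (`< h + 2`) is an agreement pair or a right-way `Δ`-pair. -/
theorem dcore_lt (p q : Finset (Fin h)) (a : Fin h) (β : Bool) (c : Fin h) (γ : Bool)
    (hlt : dcore p q a β c γ < h + 2) :
    (a = c ∧ β = γ) ∨
      (a ∈ symmDiff p q ∧ c ∈ symmDiff p q ∧ β = decide (a ∈ p) ∧ γ = decide (c ∈ q)) := by
  unfold dcore at hlt
  by_cases h1 : a = c ∧ β = γ
  · exact Or.inl h1
  by_cases h2 : a ∈ symmDiff p q ∧ c ∈ symmDiff p q ∧ β = decide (a ∈ p) ∧ γ = decide (c ∈ q)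
  · exact Or.inr h2
  rw [if_neg h1, if_neg h2] at hlt
  exact (lt_irrefl _ hlt).elim

/-- A non-agreement pair costs at least `1`. -/
theorem one_le_dcore (p q : Finset (Fin h)) (a : Fin h) (β : Bool) (c : Fin h) (γ : Bool)
    (hne : ¬ (a = c ∧ β = γ)) : 1 ≤ dcore p q a β c γ := by
  unfold dcore; split_ifs <;> omega

/-- A non-agreement pair that is not forward (`¬ a < c`) costs at least `2`. -/
theorem two_le_dcore (p q : Finset (Fin h)) (a : Fin h) (β : Bool) (c : Fin h) (γ : Bool)
    (hne : ¬ (a = c ∧ β = γ)) (hac : ¬ a < c) : 2 ≤ dcore p q a β c γ := by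
  unfold dcore; split_ifs <;> omega

/-- A right-way `Δ`-pair that is not an agreement pair costs `1` forward and `2` otherwise. -/
theorem dcore_rightway (p q : Finset (Fin h)) (a c : Fin h) (ha : a ∈ symmDiff p q)
    (hc : c ∈ symmDiff p q) (hne : ¬ (a = c ∧ decide (a ∈ p) = decide (c ∈ q))) :
    dcore p q a (decide (a ∈ p)) c (decide (c ∈ q)) = if a < c then 1 else 2 := by
  unfold dcore
  rw [if_neg hne, if_pos ⟨ha, hc, rfl, rfl⟩]

/-! ## 3. Block sums and the block lower bound -/

/-- The block sum of the inner assignment `τ` for the block (row point `x`, column point `y`):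
`Σ_a dcore (a, [a ∈ x]) (τ a, [τ a ∈ y])`. -/
def bsum (p q x y : Finset (Fin h)) (τ : Equiv.Perm (Fin h)) : ℕ :=
  ∑ a, dcore p q a (decide (a ∈ x)) (τ a) (decide (τ a ∈ y))

/-- Each term is bounded by the block sum. -/
theorem term_le_bsum (p q x y : Finset (Fin h)) (τ : Equiv.Perm (Fin h)) (a : Fin h) :
    dcore p q a (decide (a ∈ x)) (τ a) (decide (τ a ∈ y)) ≤ bsum p q x y τ :=
  Finset.single_le_sum (f := fun a => dcore p q a (decide (a ∈ x)) (τ a) (decide (τ a ∈ y)))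
    (fun _ _ => Nat.zero_le _) (mem_univ a)

/-- An identity block costs `0` at the identity assignment. -/
theorem bsum_self_one (p q x : Finset (Fin h)) : bsum p q x x 1 = 0 := by
  unfold bsum
  exact Finset.sum_eq_zero (fun a _ => by rw [Equiv.Perm.coe_one, id, dcore_self])

/-- MONOTONICITY: a block of finite cost (`< h + 2`) has every mismatch coordinate in `Δ`, with the
row bit equal to `p`'s bit there. -/
theorem mono_of_bsum_lt (p q x y : Finset (Fin h)) (τ : Equiv.Perm (Fin h))
    (hlt : bsum p q x y τ < h + 2) :
    ∀ a ∈ symmDiff x y, a ∈ symmDiff p q ∧ (a ∈ x ↔ a ∈ p) := by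
  intro a ha
  have hterm := lt_of_le_of_lt (term_le_bsum p q x y τ a) hlt
  rw [Finset.mem_symmDiff] at ha
  rcases dcore_lt p q _ _ _ _ hterm with ⟨h1, h2⟩ | ⟨h1, -, h3, -⟩
  · exfalso
    rw [← h1, decide_eq_decide] at h2
    tauto
  · rw [decide_eq_decide] at h3
    exact ⟨h1, h3⟩

/-- In a block of finite cost every moved coordinate (`τ a ≠ a`) lands in the mismatch set. -/
theorem mem_symmDiff_of_ne (p q x y : Finset (Fin h)) (τ : Equiv.Perm (Fin h))
    (hlt : bsum p q x y τ < h + 2) (a : Fin h) (ha : τ a ≠ a) : τ a ∈ symmDiff x y := by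
  -- the pair at `a` is not an agreement pair, so it is right-way: `τ a ∈ Δ`, column bit `= q`'s
  have hta := lt_of_le_of_lt (term_le_bsum p q x y τ a) hlt
  rcases dcore_lt p q _ _ _ _ hta with ⟨h1, -⟩ | ⟨-, h2, -, h4⟩
  · exact absurd h1.symm ha
  -- the pair at `b := τ a` is not an agreement pair either (`τ b ≠ b` by injectivity), so the
  -- row bit of `b` is `p`'s
  have hb : τ (τ a) ≠ τ a := fun hfix => ha (τ.injective hfix)
  have htb := lt_of_le_of_lt (term_le_bsum p q x y τ (τ a)) hlt
  rcases dcore_lt p q _ _ _ _ htb with ⟨h1, -⟩ | ⟨-, -, h3, -⟩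
  · exact absurd h1.symm hb
  rw [decide_eq_decide] at h3 h4
  rw [Finset.mem_symmDiff] at h2 ⊢
  tauto

/-- BLOCK LOWER BOUND: every inner assignment of the block `(x, y)` costs at least
`|x ∆ y| + [x ≠ y]` (the largest mismatch coordinate cannot be paired forward). -/
theorem card_add_le_bsum (p q x y : Finset (Fin h)) (τ : Equiv.Perm (Fin h)) :
    (symmDiff x y).card + (if x = y then 0 else 1) ≤ bsum p q x y τ := by
  by_cases hlt : bsum p q x y τ < h + 2
  swap
  · have hcard : (symmDiff x y).card ≤ h := (card_le_univ _).trans (by simp)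
    split_ifs <;> omega
  by_cases hxy : x = y
  · subst hxy; simp
  rw [if_neg hxy]
  have hM : (symmDiff x y).Nonempty := by
    rw [Finset.nonempty_iff_ne_empty, ← Finset.bot_eq_empty, Ne, symmDiff_eq_bot]
    exact hxy
  set f : Fin h → ℕ := fun a => dcore p q a (decide (a ∈ x)) (τ a) (decide (τ a ∈ y)) with hf
  -- every mismatch coordinate costs ≥ 1
  have hone : ∀ a ∈ symmDiff x y, 1 ≤ f a := by
    intro a ha
    refine one_le_dcore p q _ _ _ _ ?_
    rintro ⟨h1, h2⟩
    rw [← h1, decide_eq_decide] at h2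
    rw [Finset.mem_symmDiff] at ha
    tauto
  -- the largest mismatch coordinate costs ≥ 2
  obtain ⟨a₀, ha₀, hmax⟩ := Finset.exists_max_image (symmDiff x y) (fun a => a) hM
  have htwo : 2 ≤ f a₀ := by
    refine two_le_dcore p q _ _ _ _ ?_ ?_
    · rintro ⟨h1, h2⟩
      rw [← h1, decide_eq_decide] at h2
      rw [Finset.mem_symmDiff] at ha₀
      tauto
    · intro hlt'
      have hne : τ a₀ ≠ a₀ := fun heq => by rw [heq] at hlt'; exact lt_irrefl _ hlt'
      have hmem := mem_symmDiff_of_ne p q x y τ hlt a₀ hne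
      exact absurd (hmax (τ a₀) hmem) (not_le.mpr hlt')
  -- sum up
  have hsub : ∑ a ∈ symmDiff x y, f a ≤ bsum p q x y τ :=
    Finset.sum_le_sum_of_subset_of_nonneg (subset_univ _) (fun _ _ _ => Nat.zero_le _)
  have hsplit := Finset.add_sum_erase (symmDiff x y) f ha₀
  have herase : ((symmDiff x y).erase a₀).card • 1 ≤ ∑ a ∈ (symmDiff x y).erase a₀, f a :=
    Finset.card_nsmul_le_sum _ _ _ (fun a ha => hone a (Finset.mem_of_mem_erase ha))
  rw [Finset.card_erase_of_mem ha₀, smul_eq_mul, mul_one] at herase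
  have hpos : 0 < (symmDiff x y).card := Finset.card_pos.mpr hM
  omega

/-! ## 4. The potential -/

/-- The potential `Φ z = #{a ∈ Δ : [a ∈ z] = [a ∈ q]}` (number of `Δ`-coordinates where `z` already
carries `q`'s bit). -/
def phi (Δ q z : Finset (Fin h)) : ℕ := (Δ.filter (fun a => (a ∈ z ↔ a ∈ q))).card

/-- On a monotone block the potential increases exactly by the number of mismatches. -/
theorem phi_eq_of_mono (p q x y : Finset (Fin h))
    (hmono : ∀ a ∈ symmDiff x y, a ∈ symmDiff p q ∧ (a ∈ x ↔ a ∈ p)) :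
    phi (symmDiff p q) q y = phi (symmDiff p q) q x + (symmDiff x y).card := by
  unfold phi
  have hdisj : Disjoint ((symmDiff p q).filter (fun a => (a ∈ x ↔ a ∈ q))) (symmDiff x y) := by
    rw [Finset.disjoint_left]
    intro a ha hM
    obtain ⟨hΔ, hxp⟩ := hmono a hM
    rw [Finset.mem_filter] at ha
    rw [Finset.mem_symmDiff] at hΔ
    tauto
  rw [← Finset.card_union_of_disjoint hdisj]
  congr 1
  ext a
  simp only [Finset.mem_union, Finset.mem_filter]
  by_cases hM : a ∈ symmDiff x y
  · obtain ⟨hΔ, hxp⟩ := hmono a hM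
    have hΔ' := hΔ
    have hM' := hM
    rw [Finset.mem_symmDiff] at hΔ' hM'
    tauto
  · have hM' := hM
    rw [Finset.mem_symmDiff] at hM'
    tauto

/-- `Φ q = |Δ|`. -/
theorem phi_right (p q : Finset (Fin h)) : phi (symmDiff p q) q q = (symmDiff p q).card := by
  unfold phi; congr 1; ext a; simp

/-- `Φ p = 0`. -/
theorem phi_left (p q : Finset (Fin h)) : phi (symmDiff p q) q p = 0 := by
  unfold phi
  rw [Finset.card_eq_zero, Finset.filter_eq_empty_iff]
  intro a ha
  rw [Finset.mem_symmDiff] at ha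
  tauto

/-! ## 5. The increasing cycle and the cost of the exchange block -/

/-- The increasing cycle on a finset `s = {a₀ < a₁ < … < a_{k-1}}` of `Fin h` (`a_i ↦ a_{i+1}`,
`a_{k-1} ↦ a₀`), extended by the identity off `s`. -/
noncomputable def incCycle (s : Finset (Fin h)) (k : ℕ) (hk : s.card = k) : Equiv.Perm (Fin h) :=
  (finRotate k).extendDomain (s.orderIsoOfFin hk).toEquiv

/-- Off `s` the increasing cycle is the identity. -/
theorem incCycle_of_not_mem (s : Finset (Fin h)) (k : ℕ) (hk : s.card = k) (a : Fin h)
    (ha : a ∉ s) : incCycle s k hk a = a :=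
  Equiv.Perm.extendDomain_apply_not_subtype _ _ ha

/-- On the `i`-th element of `s` the increasing cycle gives the `(i+1 mod k)`-th element. -/
theorem incCycle_apply_image (s : Finset (Fin h)) (k : ℕ) (hk : s.card = k) (i : Fin k) :
    incCycle s k hk ((s.orderIsoOfFin hk) i) = (s.orderIsoOfFin hk) (finRotate k i) :=
  Equiv.Perm.extendDomain_apply_image _ _ i

/-- THE EXCHANGE BLOCK: at the increasing cycle on `Δ = p ∆ q` (nonempty, `|Δ| = k + 1`) the block
`(p, q)` costs exactly `|Δ| + 1` (`k` forward pairs and one backward/diagonal pair). -/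
theorem bsum_incCycle (p q : Finset (Fin h)) (k : ℕ) (hk : (symmDiff p q).card = k + 1) :
    bsum p q p q (incCycle (symmDiff p q) (k + 1) hk) = k + 2 := by
  set Δ := symmDiff p q with hΔ
  set τ := incCycle Δ (k + 1) hk with hτ
  set F := Δ.orderIsoOfFin hk with hF
  unfold bsum
  rw [← Finset.sum_add_sum_compl Δ]
  -- off `Δ`: agreement pairs, cost 0
  have hoff : ∑ a ∈ Δᶜ, dcore p q a (decide (a ∈ p)) (τ a) (decide (τ a ∈ q)) = 0 := by
    refine Finset.sum_eq_zero (fun a ha => ?_)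
    rw [Finset.mem_compl] at ha
    have hpq : decide (a ∈ q) = decide (a ∈ p) := by
      rw [decide_eq_decide]
      rw [hΔ, Finset.mem_symmDiff] at ha
      tauto
    rw [hτ, incCycle_of_not_mem Δ (k + 1) hk a ha, hpq, dcore_self]
  rw [hoff, add_zero]
  -- on `Δ`: right-way pairs, `1` forward / `2` otherwise
  have hon : ∀ a ∈ Δ, dcore p q a (decide (a ∈ p)) (τ a) (decide (τ a ∈ q)) =
      if a < τ a then 1 else 2 := by
    intro a ha
    have hτa : τ a ∈ Δ := by
      obtain ⟨i, rfl⟩ : ∃ i : Fin (k + 1), (F i : Fin h) = a :=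
        ⟨F.symm ⟨a, ha⟩, by rw [OrderIso.apply_symm_apply]⟩
      rw [hτ, hF, incCycle_apply_image]
      exact Subtype.coe_prop _
    refine dcore_rightway p q a (τ a) ha hτa ?_
    rintro ⟨h1, h2⟩
    rw [← h1, decide_eq_decide] at h2
    rw [hΔ, Finset.mem_symmDiff] at ha
    tauto
  rw [Finset.sum_congr rfl hon]
  -- reindex along the order isomorphism `F : Fin (k+1) ≃o Δ`
  rw [← Finset.sum_coe_sort Δ, ← Equiv.sum_comp F.toEquiv]
  have hstep : ∀ i : Fin (k + 1),
      (if ((F.toEquiv i : Δ) : Fin h) < τ ((F.toEquiv i : Δ) : Fin h) then 1 else 2) =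
        if i = Fin.last k then 2 else 1 := by
    intro i
    have h1 : τ ((F i : Δ) : Fin h) = ((F (finRotate (k + 1) i) : Δ) : Fin h) := by
      rw [hτ, hF]; exact incCycle_apply_image Δ (k + 1) hk i
    have h2 : ((F i : Δ) : Fin h) < ((F (finRotate (k + 1) i) : Δ) : Fin h) ↔ i ≠ Fin.last k := by
      rw [Subtype.coe_lt_coe, OrderIso.lt_iff_lt, lt_finRotate_iff_ne_last]
    change (if ((F i : Δ) : Fin h) < τ ((F i : Δ) : Fin h) then 1 else 2) = _
    rw [h1]
    rcases Decidable.em (i = Fin.last k) with hi | hi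
    · have h3 : ¬ ((F i : Δ) : Fin h) < ((F (finRotate (k + 1) i) : Δ) : Fin h) :=
        fun hlt' => (h2.mp hlt') hi
      rw [if_neg h3, if_pos hi]
    · rw [if_pos (h2.mpr hi), if_neg hi]
  have hlast : (if Fin.last k = Fin.last k then 2 else 1) = 2 := if_pos rfl
  have hcs : ∀ i : Fin k, (if Fin.castSucc i = Fin.last k then 2 else 1) = 1 :=
    fun i => if_neg (Fin.castSucc_lt_last i).ne
  rw [Finset.sum_congr rfl (fun i _ => hstep i), Fin.sum_univ_castSucc, hlast,
    Finset.sum_congr rfl (fun i _ => hcs i)]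
  simp

end Summit.ValiantsHypothesis.ValiantsHypothesis.Theorems.BarrierLever.NearPrincipal
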